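import Mathlib.AlgebraicGeometry.Normalization
import Mathlib.AlgebraicGeometry.Morphisms.Etale
import Mathlib.AlgebraicGeometry.Morphisms.Proper
import Literature.AlgebraicGeometry.Resolution.SteinFinitePartEtaleAlgebra
import HarnessLib

/-!
# The finite part of a Stein factorisation over an affine base is étale when `Γ` is

Topic: `Literature/AlgebraicGeometry/Resolution`. Two small bridges for de Jong 1996, 4.12
("`Y' → ℙ^{d-1}` is (finite) étale", the named fact `DeJong1996SteinFactorizationEtale`):

* `etale_fromNormalization_of_etale_appTop` — for `f : X → U` quasi-compact, quasi-separated
  and universally closed onto an AFFINE `U`, if `Γ(U) → Γ(X)` is an étale ring map then the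
  finite part `Y' = f.normalization → U` of the Stein factorisation (Mathlib's relative
  normalization, Stacks 035H) is étale: `Y'` is affine with ring the integral closure of `Γ(U)`
  in `Γ(X)` (`Scheme.Hom.fromNormalization_app`), which is all of `Γ(X)` because `Γ(X)` is
  integral over `Γ(U)` (`isIntegral_appTop_of_universallyClosed`, Stacks 03GQ);
* `etale_of_idempotents_met_by_sections` — the algebraic endpoint of the argument of 4.12: an
  integral `R`-algebra `B`, integrally closed in an ambient finite product of fields `E ⊇ B`,
  every non-zero idempotent of which is sent to `1` by some `R`-algebra map `B → R` (a section),
  is étale over `R` — indeed `B ≃ Rⁿ` (`SteinFinitePartEtaleAlgebra.lean`).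

[folklore]; no definitions, no named facts.

## Sources

* The Stacks Project, Tags 035H, 03GQ, 00U3. [StacksProject]
* A. J. de Jong, *Smoothness, semi-stability and alterations*, Publ. Math. IHÉS 83 (1996), 4.12,
  p. 68. [DeJong1996]
-/

noncomputable section

open CategoryTheory CategoryTheory.Limits AlgebraicGeometry TopologicalSpace

namespace Literature.AlgebraicGeometry.Resolution

universe u

/-- **`Y' → U` is étale when `Γ(U) → Γ(X)` is** (`U` affine, `f : X → U` quasi-compact,
quasi-separated, universally closed): `Y' = f.normalization` is affine over `U` with ring the
integral closure of `Γ(U)` in `Γ(X)`, i.e. `Γ(X)` itself. [cite: StacksProject, Tag 03GQ] -/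
theorem etale_fromNormalization_of_etale_appTop {X U : Scheme.{u}} (f : X ⟶ U) [IsAffine U]
    [QuasiCompact f] [QuasiSeparated f] [UniversallyClosed f] (h : f.appTop.hom.Etale) :
    Etale f.fromNormalization := by
  haveI : IsAffine f.normalization := isAffine_of_isAffineHom f.fromNormalization
  rw [HasRingHomProperty.iff_of_isAffine (P := @Etale)]
  change (f.fromNormalization.app ⊤).hom.Etale
  rw [f.fromNormalization_app (isAffineOpen_top U), CommRingCat.hom_comp, CommRingCat.hom_ofHom]
  algebraize [f.appTop.hom]
  -- `Γ(X)` is integral over `Γ(U)`, so the integral closure is everything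
  have hint : Algebra.IsIntegral Γ(U, ⊤) Γ(X, ⊤) := ⟨isIntegral_appTop_of_universallyClosed f⟩
  have htop : integralClosure Γ(U, ⊤) Γ(X, ⊤) = ⊤ :=
    le_antisymm le_top fun x _ => hint.isIntegral x
  let e : ↥(integralClosure Γ(U, ⊤) Γ(X, ⊤)) ≃ₐ[Γ(U, ⊤)] Γ(X, ⊤) :=
    (Subalgebra.equivOfEq _ _ htop).trans Subalgebra.topEquiv
  haveI : Algebra.Etale Γ(U, ⊤) Γ(X, ⊤) := h
  haveI : Algebra.Etale Γ(U, ⊤) ↥(integralClosure Γ(U, ⊤) Γ(X, ⊤)) := Algebra.Etale.of_equiv e.symm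
  have hic : (algebraMap Γ(U, ⊤) ↥(integralClosure Γ(U, ⊤) Γ(X, ⊤))).Etale :=
    RingHom.etale_algebraMap.mpr inferInstance
  exact RingHom.Etale.respectsIso.1 _
    (f.normalizationObjIso (isAffineOpen_top U)).symm.commRingCatIsoToRingEquiv hic

/-- **The algebraic endpoint of de Jong 1996, 4.12**: let `B` be an `R`-algebra, integral over
`R`, with an injective structure map into an ambient `E ≃ ∏ᵢ Fᵢ` (fields) in which `B` is
integrally closed, and suppose every non-zero idempotent `e ∈ B` is met by a section:
`s e = 1` for some `R`-algebra map `s : B → R`. Then `B` is étale over `R` (the idempotents of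
`E` lie in `B`, every factor `B ⧸ (1 - eᵢ)` is a domain with a retraction, hence is `R`, and
`B ≃ Rⁿ`). [folklore] -/
theorem etale_of_idempotents_met_by_sections {R B E : Type u} [CommRing R] [CommRing B]
    [CommRing E] [Algebra R B] [Algebra B E] [Algebra.IsIntegral R B]
    (hinj : Function.Injective (algebraMap B E))
    (hic : ∀ z : E, IsIntegral B z → z ∈ (algebraMap B E).range)
    {ι : Type u} [Fintype ι] [DecidableEq ι] {F : ι → Type u} [∀ i, Field (F i)]
    (eE : E ≃+* Π i, F i)
    (hsec : ∀ e : B, IsIdempotentElem e → e ≠ 0 → ∃ s : B →ₐ[R] R, s e = 1) :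
    Algebra.Etale R B := by
  obtain ⟨e, he, hstd, hker⟩ := exists_completeOrthogonalIdempotents_of_integrallyClosedIn' hinj hic eE
  refine etale_of_completeOrthogonalIdempotents_of_bijective he fun i => ?_
  haveI := isDomain_quotient_span_one_sub' eE i (hker i)
  have hne : e i ≠ 0 := by
    intro h0
    have h1 := congrFun (hstd i) i
    rw [h0, map_zero, map_zero] at h1
    simp at h1
  obtain ⟨s, hs⟩ := hsec (e i) (he.idem i) hne
  exact bijective_algebraMap_quotient_of_apply_eq_one s (e i) hs

end Literature.AlgebraicGeometry.Resolution

end
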